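import Summits.QuantumFields.BalabanUV.Beta.GAN24.AffineUnrollProjected
import Summits.QuantumFields.BalabanUV.Beta.GAN24.SecondOrderReadersParity
import Summits.QuantumFields.BalabanUV.Beta.GAN24.Lin4LegDivergence
import Summits.QuantumFields.BalabanUV.Beta.GAN24.LayerCommutatorAntisymm

/-!
# `BalabanUV.Beta.GAN24.Lin4ParityCovariance` — binder row G-an2-4 / (CONV-C), W-slot EXIT (α) (RULING R-lead-g77-1 (2); the OWNER gan24-p1 g33's (α-END)
# INTENT I-gan24p1-g33-3, piece (α-END-a), and his ASK l.49438 «`P ∘ 𝒜_j = 𝒜_j ∘ P` for `𝒜_j = lin4 c (unitK_j K_j) Lc` (undressed) AND for the dressed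
# `lin4 c (unitK_j Ĝ_j) Lc`»): **THE SLOTWISE PARITY `P := sgnK ∘ trK` COMMUTES WITH ROAD W3's ONE-STEP MAP `lin4 c K N` ON BOUNDED BI-TABLES, FOR EVERY DECAYING
# sgn-SYMMETRIC KERNEL `K`** — hence with the DRESSED and the UNDRESSED unit steps of an2's comb tower; so the displayed hypothesis `hpA` of MY
# `AffineUnrollProjected.unitS₂_T2RecAt_half_eq_transportB_add_sum_cell` is DISCHARGED and (α-END-a) «THE EVEN HSPLIT» holds HYPOTHESIS-FREE
# (G-an2-4 FORMAL swarm → CRUX TEAM (2), leaf-01 lineage `b2b-balaban-gan24-formalise-leaf-01`, gen 71).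

NOT IN PRINT; OUR BOOKKEEPING.  HONEST FRAMING (cell contract, verbatim): «discharging `BetaPertH` makes Bałaban's UV stability UNCONDITIONAL — a real
constructive-QFT result; it is NOT the continuum limit and NOT the Clay problem.»  HONEST DEPENDENCY (verbatim): «continuum YM on T⁴ ⇐ BetaPertH ∧ nine spine
estimates (0/9 proved); BetaPertH ⇐ (D1) ∧ (D4) ∧ CAP+tail; G-an2-4 gates asym, D1 and NE2/3/4.»  [folklore] kernel algebra BY NAME: leaf-03 g65's
`SecondOrderReadersParity.{sgnK_trK_vertex2OfK, sgnK_trK_comp, sgnK_trK_add, sgnK_trK_smul, sgnK_trK_neg, abs_sgnK_trK_apply}` (the readers' covariance,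
UNCONDITIONAL), leaf-03's `LayerCommutatorAntisymm.{trK_unitK_coDress, trK_unitK_eq_sgnK}` and `LayerPushAntisymm`-style `mm`-read bookkeeping (re-derived in four
block cases), leaf-04's `Lin4LegDivergence.comp_assoc_dbd` (the bounded sandwich re-associates) and `Lin4Additive.abs_vsym_le`, an2's `BubbleParity.trK_KInvStep`,
`BorderedHessianSymmetry.sgnK_sgnK`, asym1's `decays_coDressKBmAt_KInvStep`, MY `AffineUnrollProjected` (PART 1 of (α-END-a)).  No cited fact, no `def`, no
`def … : Prop`, 0 sorry.  Asserts NO shape, NO bound, NO rate of any table; discharges NOTHING of «T2Shape» ∕ «T2Drift» ∕ (hW, hWall) ∕ (C) ∕ (Q-L); (β) of record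
untouched; NEVER «G-an2-4 closed» as (CONV-C); NOT D1, NOT BetaPertH, NOT continuum, NOT Clay.

* §1 `mmRead_sgnK` (the `mm`-read does not see `sgnK` INSIDE: it reads the mm-block, where `sgnF·sgnF = 1`), `sgnK_trK_mmRead` (`P (mmRead N F) = mmRead N (P F)`),
  **`sgnK_trK_vsym`** (`P (vsym K N T b b′) = vsym K N (P∘T) b b′`, UNCONDITIONAL — leaf-03's bi-vertex covariance twice).
* §2 **`sgnK_trK_lin4`**: for `K` decaying at a positive rate with `trK K = sgnK K`, every `c N`, every bounded bi-table `X`: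
  `(κ u κ′ u′ ↦ P (lin4 c K N X κ u κ′ u′)) = lin4 c K N (P∘X)` — `lin4 = −c • mmRead N (K ∘ vsym ∘ K)`; `P` is anti-multiplicative termwise, fixes `K`, passes the
  `mm`-read, and the bounded sandwich re-associates (`comp_assoc_dbd`).
* §3 the comb tower's steps (in-block root `ρ = toSite r`, level units `(sfStep Lc j, smStep d Lc j)`): **`sgnK_trK_lin4_unitK_coDress`** (DRESSED `Ĝ_j = coDressKBmAt ρ Lc (KInvStep Lc j)`)
  and **`sgnK_trK_lin4_unitK_KInvStep`** (UNDRESSED) — the OWNER's two asked commutations.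
* §4 **`unitS₂_T2RecAt_half_eq_transportB_add_sum_cell'`** = MY PART 1's (α-END-a) with `hpA` DISCHARGED: for an2's comb `T₂` tower, every root in the block, pins, initial
  table, off-diagonal `LocStencil₂` border, every `c ε n` — `c • (T̃_n + ε • P T̃_n) = 𝒯^B(0,n) (c • (T̃_0 + ε • P T̃_0)) + Σ_{l<n} 𝒯^B(l+1,n−1−l) (c • (b̃_l + ε • P b̃_l) + (𝒜^Ĝ_l y_l − 𝒜^K_l y_l))`,
  HYPOTHESIS-FREE beyond the border's two displayed shape rows (`hBff hBmm hB`, as in MY g62 `T2HybridCellsComb`).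
-/

noncomputable section

open Finset
open scoped BigOperators
open Literature.MathematicalPhysics.QuantumFieldTheory
open Literature.MathematicalPhysics.QuantumFieldTheory.Balaban1983to89
open Literature.MathematicalPhysics.QuantumFieldTheory.Balaban1983to89.Beta
open ExpKernelCalculus (MKer Decays BiLoc VertexFamily VertexFamily₂ comp)
open KernelWard (Bdd)
open OneStepResolventKernel (Fib LocStencil)
open OneStepKernelFamily (KInvStep decays_KInvStep)
open AffineAveraging (box toSite)
open AveragingMixedJetTables (mixFFAt)
open SecondOrderResponse (W2SymOfK vertex2OfK LocStencilFM)
open BalabanCompositeJets (LocStencil₂)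
open BalabanStepJetsSucc (mmRead mmRead_inl_inl mmRead_inr_left mmRead_inr_right)
open BalabanStepW2 (K3OfK M2Of)
open Summit.QuantumFields.BalabanUV.Beta.TameKernelCalculus (trK trK_apply)
open Summit.QuantumFields.BalabanUV.Beta.BorderedHessian (sgnF sgnF_inr sgnK sgnK_apply sgnK_sgnK)
open Summit.QuantumFields.BalabanUV.Beta.BubbleParity (trK_KInvStep)
open Summit.QuantumFields.BalabanUV.Beta.HessKerDressedUnits (unitK unitS decays_unitK)
open Summit.QuantumFields.BalabanUV.Beta.SecondOrderUnits (unitM unitS₂ unitM₂)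
open Summit.QuantumFields.BalabanUV.Beta.AxialDressingRooted (coDressKBmAt decays_coDressKBmAt_KInvStep)
open Summit.QuantumFields.BalabanUV.Beta.SpineRooted (T2RecAt SpureRecAt M1At)
open Summit.QuantumFields.BalabanUV.Beta.GAN24.CombesThomas (sfStep smStep)
open Summit.QuantumFields.BalabanUV.Beta.GAN24.T2RecursionAffine (lin4 lin4_apply vsym)
open Summit.QuantumFields.BalabanUV.Beta.GAN24.AffineUnroll (transport)
open Summit.QuantumFields.BalabanUV.Beta.GAN24.Lin4Additive (abs_vsym_le)
open Summit.QuantumFields.BalabanUV.Beta.GAN24.Lin4LegDivergence (comp_assoc_dbd)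
open Summit.QuantumFields.BalabanUV.Beta.GAN24.LayerCommutatorAntisymm (trK_unitK_coDress trK_unitK_eq_sgnK)
open Summit.QuantumFields.BalabanUV.Beta.GAN24.SecondOrderReadersParity (sgnK_trK_vertex2OfK sgnK_trK_comp sgnK_trK_add sgnK_trK_smul sgnK_trK_neg
  abs_sgnK_trK_apply)
open Summit.QuantumFields.BalabanUV.Beta.GAN24.AffineUnrollProjected (unitS₂_T2RecAt_half_eq_transportB_add_sum_cell)

namespace Summit.QuantumFields.BalabanUV.Beta.GAN24.Lin4ParityCovariance

variable {d : ℕ}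

/-! ## §1 The `mm`-read and the symmetrised bi-vertex are parity-covariant -/

/-- [folklore] **THE `mm`-READ DOES NOT SEE `sgnK` INSIDE**: `mmRead M (sgnK F) = mmRead M F` (it reads the mm-block of `F` into the ff-block; `sgnF (inr ·)² = 1`). -/
theorem mmRead_sgnK (M : ℕ) (F : MKer (d + 1) (Fib d)) : mmRead M (sgnK F) = mmRead M F := by
  funext x z a b
  rcases a with α | μ <;> rcases b with β | ν
  · rw [mmRead_inl_inl, mmRead_inl_inl, sgnK_apply, sgnF_inr, sgnF_inr]
    ring
  · rw [mmRead_inr_right, mmRead_inr_right]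
  · rw [mmRead_inr_left, mmRead_inr_left]
  · rw [mmRead_inr_left, mmRead_inr_left]

/-- [folklore] **THE SLOTWISE PARITY PASSES THE `mm`-READ**: `sgnK (trK (mmRead M F)) = mmRead M (sgnK (trK F))` (the transpose commutes with the read — four block cases —,
`sgnK` fixes an ff-supported kernel outside and is invisible inside). -/
theorem sgnK_trK_mmRead (M : ℕ) (F : MKer (d + 1) (Fib d)) : sgnK (trK (mmRead M F)) = mmRead M (sgnK (trK F)) := by
  rw [mmRead_sgnK]
  funext x z a b
  rcases a with α | μ <;> rcases b with β | ν
  · rw [sgnK_apply, trK_apply, mmRead_inl_inl, mmRead_inl_inl, trK_apply]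
    simp [BorderedHessian.sgnF]
  · rw [sgnK_apply, trK_apply, mmRead_inr_right, mmRead_inr_left, mul_zero]
  · rw [sgnK_apply, trK_apply, mmRead_inr_left, mmRead_inr_right, mul_zero]
  · rw [sgnK_apply, trK_apply, mmRead_inr_left, mmRead_inr_left, mul_zero]

/-- [folklore] **THE SYMMETRISED BI-VERTEX IS PARITY-COVARIANT, FOR ANY WEIGHT KERNEL** (UNCONDITIONAL): `sgnK (trK (vsym K N T b b′)) = vsym K N (P∘T) b b′`
(leaf-03's `sgnK_trK_vertex2OfK` on both orderings of the slots). -/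
theorem sgnK_trK_vsym (K : MKer (d + 1) (Fib d)) (N : ℕ)
    (T : Fin (d + 1) → (Fin (d + 1) → ℤ) → Fin (d + 1) → (Fin (d + 1) → ℤ) → MKer (d + 1) (Fib d))
    (μ : Fin (d + 1)) (y : Fin (d + 1) → ℤ) (ν : Fin (d + 1)) (y' : Fin (d + 1) → ℤ) :
    sgnK (trK (vsym K N T μ y ν y')) = vsym K N (fun κ u κ' u' => sgnK (trK (T κ u κ' u'))) μ y ν y' := by
  simp only [vsym]
  rw [sgnK_trK_smul, sgnK_trK_add, sgnK_trK_vertex2OfK, sgnK_trK_vertex2OfK]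

/-! ## §2 The parity commutes with `lin4 c K N` on bounded bi-tables -/

/-- NOT IN PRINT; OUR BOOKKEEPING.  **THE SLOTWISE PARITY COMMUTES WITH ROAD W3's ONE-STEP MAP**: for a kernel `K` decaying at a positive rate and sgn-SYMMETRIC
(`trK K = sgnK K`), every scalar `c`, blocking `N` and every BOUNDED bi-table `X`:
`(κ u κ′ u′ ↦ sgnK (trK (lin4 c K N X κ u κ′ u′))) = lin4 c K N (κ u κ′ u′ ↦ sgnK (trK (X κ u κ′ u′)))`.
`lin4 c K N X b b′ = −(c • mmRead N (K ∘ vsym K N X b b′ ∘ K))`; the parity is linear and passes the read (§1), is ANTI-multiplicative on `∘` termwise (leaf-03), fixes `K`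
(`sgnK (trK K) = K`), re-associates the bounded sandwich (leaf-04's `comp_assoc_dbd`, `vsym` of a bounded table bounded by `abs_vsym_le`), and is `vsym`-covariant (§1). -/
theorem sgnK_trK_lin4 {K : MKer (d + 1) (Fib d)} {C δ : ℝ} (hK : Decays K C δ) (hδ : 0 < δ) (hKt : trK K = sgnK K) (c : ℝ) (N : ℕ)
    {X : Fin (d + 1) → (Fin (d + 1) → ℤ) → Fin (d + 1) → (Fin (d + 1) → ℤ) → MKer (d + 1) (Fib d)}
    (hX : ∃ B : ℝ, ∀ κ u κ' u' x z a b, |X κ u κ' u' x z a b| ≤ B) :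
    (fun κ u κ' u' => sgnK (trK (lin4 c K N X κ u κ' u'))) = lin4 c K N (fun κ u κ' u' => sgnK (trK (X κ u κ' u'))) := by
  obtain ⟨B, hB⟩ := hX
  have hKP : sgnK (trK K) = K := by rw [hKt, sgnK_sgnK]
  funext κ u κ' u'
  have hPV : Bdd (sgnK (trK (vsym K N X κ u κ' u'))) _ := fun x z a b => by
    rw [abs_sgnK_trK_apply]
    exact abs_vsym_le hK hδ N hB κ u κ' u' z x b a
  rw [lin4_apply, lin4_apply, sgnK_trK_neg, sgnK_trK_smul, sgnK_trK_mmRead, sgnK_trK_comp, sgnK_trK_comp, hKP,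
    comp_assoc_dbd hK hδ hPV, sgnK_trK_vsym]

/-! ## §3 The comb tower's dressed and undressed unit steps -/

section Steps

variable {Lc : ℕ} [NeZero Lc] {r : Fin (d + 1) → ℕ}

/-- NOT IN PRINT; OUR BOOKKEEPING.  **THE PARITY COMMUTES WITH THE DRESSED UNIT STEP** `lin4 c (unitK_j Ĝ_j) Lc`, `Ĝ_j = coDressKBmAt (toSite r) Lc (KInvStep Lc j)` (in-block root,
any units `sf sm`, any `c`; asym1's `decays_coDressKBmAt_KInvStep` ⨾ `decays_unitK`, leaf-03's `trK_unitK_coDress`) — the OWNER's first asked commutation; `hpA` of MY PART 1. -/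
theorem sgnK_trK_lin4_unitK_coDress (hr : r ∈ box (d + 1) Lc) (j : ℕ) (sf sm c : ℝ)
    (X : Fin (d + 1) → (Fin (d + 1) → ℤ) → Fin (d + 1) → (Fin (d + 1) → ℤ) → MKer (d + 1) (Fib d))
    (hX : ∃ B : ℝ, ∀ κ u κ' u' x z a b, |X κ u κ' u' x z a b| ≤ B) :
    (fun κ u κ' u' => sgnK (trK (lin4 c (unitK sf sm (coDressKBmAt (toSite r) Lc (KInvStep (d := d) Lc j))) Lc X κ u κ' u'))) =
      lin4 c (unitK sf sm (coDressKBmAt (toSite r) Lc (KInvStep (d := d) Lc j))) Lc (fun κ u κ' u' => sgnK (trK (X κ u κ' u'))) := by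
  obtain ⟨δ, C, hδ, -, hK⟩ := decays_coDressKBmAt_KInvStep (d := d) hr j
  exact sgnK_trK_lin4 (decays_unitK (sf := sf) (sm := sm) hK) hδ (trK_unitK_coDress hr j sf sm) c Lc hX

/-- NOT IN PRINT; OUR BOOKKEEPING.  **THE PARITY COMMUTES WITH THE UNDRESSED UNIT STEP** `lin4 c (unitK_j (KInvStep Lc j)) Lc` (road W3's transport of record; an2's
`trK_KInvStep`, `decays_KInvStep`) — the OWNER's second asked commutation. -/
theorem sgnK_trK_lin4_unitK_KInvStep (j : ℕ) (sf sm c : ℝ)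
    (X : Fin (d + 1) → (Fin (d + 1) → ℤ) → Fin (d + 1) → (Fin (d + 1) → ℤ) → MKer (d + 1) (Fib d))
    (hX : ∃ B : ℝ, ∀ κ u κ' u' x z a b, |X κ u κ' u' x z a b| ≤ B) :
    (fun κ u κ' u' => sgnK (trK (lin4 c (unitK sf sm (KInvStep (d := d) Lc j)) Lc X κ u κ' u'))) =
      lin4 c (unitK sf sm (KInvStep (d := d) Lc j)) Lc (fun κ u κ' u' => sgnK (trK (X κ u κ' u'))) := by
  obtain ⟨δ, C, hδ, -, hK⟩ := decays_KInvStep (d := d) (Lc := Lc) j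
  exact sgnK_trK_lin4 (decays_unitK (sf := sf) (sm := sm) hK) hδ (trK_unitK_eq_sgnK (trK_KInvStep Lc j) sf sm) c Lc hX

end Steps

/-! ## §4 (α-END-a) «THE EVEN HSPLIT», HYPOTHESIS-FREE -/

section Comb

variable {Lc : ℕ} [NeZero Lc] {r : Fin (d + 1) → ℕ}

/-- NOT IN PRINT; OUR BOOKKEEPING.  **(α-END-a) FOR an2's COMB `T₂` TOWER, THE DISPLAYED COMMUTATION DISCHARGED** (§3 at `c₄ = cE₂·Lc^{2(d+1)}`, level units): for every
in-block root, pins, initial table, off-diagonal `LocStencil₂` border, every `c ε n` (`c = ½, ε = 1`: the EVEN member; `ε = −1`: the odd one),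
`c • (T̃_n + ε • P T̃_n) = 𝒯^B(0,n) (c • (T̃_0 + ε • P T̃_0)) + Σ_{l<n} 𝒯^B(l+1,n−1−l) (c • (b̃_l + ε • P b̃_l) + (𝒜^Ĝ_l y_l − 𝒜^K_l y_l))`, `y_l = c • (T̃_l + ε • P T̃_l)` —
MY `AffineUnrollProjected.unitS₂_T2RecAt_half_eq_transportB_add_sum_cell` with `hpA := sgnK_trK_lin4_unitK_coDress`. -/
theorem unitS₂_T2RecAt_half_eq_transportB_add_sum_cell' (hLc : 1 ≤ Lc) (hr : r ∈ box (d + 1) Lc) (cE cVH cΛ cE₂ cB : ℝ)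
    (Tc : Fin 4 → Fin 4 → Fin 4 → Fin 4 → ℝ) {vh₂S : Fin (d + 1) → (Fin (d + 1) → ℤ) → Fin (d + 1) → (Fin (d + 1) → ℤ) → MKer (d + 1) (Fib d)}
    (hBff : ∀ κ u κ' u' x z (α β : Fin (d + 1)), vh₂S κ u κ' u' x z (Sum.inl α) (Sum.inl β) = 0)
    (hBmm : ∀ κ u κ' u' x z (μ ν : Fin (d + 1)), vh₂S κ u κ' u' x z (Sum.inr μ) (Sum.inr ν) = 0)
    (hB : ∃ C δ : ℝ, 0 < δ ∧ LocStencil₂ vh₂S C δ) (c ε : ℝ) (n : ℕ) :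
    c • (unitS₂ (sfStep Lc n) (smStep d Lc n) (T2RecAt d Lc (toSite r) cE cVH cΛ cE₂ cB Tc vh₂S (mixFFAt (toSite r) Lc) n) +
        ε • fun κ u κ' u' => sgnK (trK (unitS₂ (sfStep Lc n) (smStep d Lc n) (T2RecAt d Lc (toSite r) cE cVH cΛ cE₂ cB Tc vh₂S (mixFFAt (toSite r) Lc) n) κ u κ' u'))) =
      transport (fun j => lin4 (cE₂ * (Lc : ℝ) ^ (2 * (d + 1))) (unitK (sfStep Lc j) (smStep d Lc j) (KInvStep (d := d) Lc j)) Lc) 0 n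
          (c • (unitS₂ (sfStep Lc 0) (smStep d Lc 0) (T2RecAt d Lc (toSite r) cE cVH cΛ cE₂ cB Tc vh₂S (mixFFAt (toSite r) Lc) 0) +
            ε • fun κ u κ' u' => sgnK (trK (unitS₂ (sfStep Lc 0) (smStep d Lc 0) (T2RecAt d Lc (toSite r) cE cVH cΛ cE₂ cB Tc vh₂S (mixFFAt (toSite r) Lc) 0) κ u κ' u')))) +
        ∑ l ∈ Finset.range n, transport (fun j => lin4 (cE₂ * (Lc : ℝ) ^ (2 * (d + 1))) (unitK (sfStep Lc j) (smStep d Lc j) (KInvStep (d := d) Lc j)) Lc) (l + 1) (n - 1 - l)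
          (c • ((fun κ u κ' u' => (cE₂ * (Lc : ℝ) ^ (2 * (d + 1))) • mmRead Lc (K3OfK (unitK (sfStep Lc l) (smStep d Lc l) (coDressKBmAt (toSite r) Lc (KInvStep (d := d) Lc l))) Lc
              (unitS (sfStep Lc l) (smStep d Lc l) (SpureRecAt d Lc (toSite r) cE cVH cΛ l)) (unitM (sfStep Lc l) (smStep d Lc l) (M1At d Lc (toSite r) cΛ l)) (W2SymOfK
              (unitK (sfStep Lc l) (smStep d Lc l) (coDressKBmAt (toSite r) Lc (KInvStep (d := d) Lc l))) Lc (unitS (sfStep Lc l) (smStep d Lc l) (SpureRecAt d Lc (toSite r) cE cVH cΛ l))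
              (unitM (sfStep Lc l) (smStep d Lc l) (M1At d Lc (toSite r) cΛ l)) 0
              (unitM₂ (sfStep Lc l) (smStep d Lc l) (M2Of d Lc (mixFFAt (toSite r) Lc) l))) κ u κ' u') + cB • vh₂S κ u κ' u') +
            ε • fun κ u κ' u' => sgnK (trK ((fun κ u κ' u' => (cE₂ * (Lc : ℝ) ^ (2 * (d + 1))) • mmRead Lc (K3OfK (unitK (sfStep Lc l) (smStep d Lc l) (coDressKBmAt (toSite r) Lc (KInvStep (d := d) Lc l))) Lc
              (unitS (sfStep Lc l) (smStep d Lc l) (SpureRecAt d Lc (toSite r) cE cVH cΛ l)) (unitM (sfStep Lc l) (smStep d Lc l) (M1At d Lc (toSite r) cΛ l)) (W2SymOfK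
              (unitK (sfStep Lc l) (smStep d Lc l) (coDressKBmAt (toSite r) Lc (KInvStep (d := d) Lc l))) Lc (unitS (sfStep Lc l) (smStep d Lc l) (SpureRecAt d Lc (toSite r) cE cVH cΛ l))
              (unitM (sfStep Lc l) (smStep d Lc l) (M1At d Lc (toSite r) cΛ l)) 0
              (unitM₂ (sfStep Lc l) (smStep d Lc l) (M2Of d Lc (mixFFAt (toSite r) Lc) l))) κ u κ' u') + cB • vh₂S κ u κ' u') κ u κ' u'))) +
           (lin4 (cE₂ * (Lc : ℝ) ^ (2 * (d + 1))) (unitK (sfStep Lc l) (smStep d Lc l) (coDressKBmAt (toSite r) Lc (KInvStep (d := d) Lc l))) Lc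
              (c • (unitS₂ (sfStep Lc l) (smStep d Lc l) (T2RecAt d Lc (toSite r) cE cVH cΛ cE₂ cB Tc vh₂S (mixFFAt (toSite r) Lc) l) +
                ε • fun κ u κ' u' => sgnK (trK (unitS₂ (sfStep Lc l) (smStep d Lc l) (T2RecAt d Lc (toSite r) cE cVH cΛ cE₂ cB Tc vh₂S (mixFFAt (toSite r) Lc) l) κ u κ' u')))) -
            lin4 (cE₂ * (Lc : ℝ) ^ (2 * (d + 1))) (unitK (sfStep Lc l) (smStep d Lc l) (KInvStep (d := d) Lc l)) Lc
              (c • (unitS₂ (sfStep Lc l) (smStep d Lc l) (T2RecAt d Lc (toSite r) cE cVH cΛ cE₂ cB Tc vh₂S (mixFFAt (toSite r) Lc) l) +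
                ε • fun κ u κ' u' => sgnK (trK (unitS₂ (sfStep Lc l) (smStep d Lc l) (T2RecAt d Lc (toSite r) cE cVH cΛ cE₂ cB Tc vh₂S (mixFFAt (toSite r) Lc) l) κ u κ' u')))))) :=
  unitS₂_T2RecAt_half_eq_transportB_add_sum_cell hLc hr cE cVH cΛ cE₂ cB Tc hBff hBmm hB
    (fun j X hX => sgnK_trK_lin4_unitK_coDress hr j (sfStep Lc j) (smStep d Lc j) (cE₂ * (Lc : ℝ) ^ (2 * (d + 1))) X hX) c ε n

end Comb

end Summit.QuantumFields.BalabanUV.Beta.GAN24.Lin4ParityCovariance
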